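import Literature.MathematicalPhysics.QuantumLattice.HubbardTorusFluxStiffnessResponse
import Literature.MathematicalPhysics.QuantumLattice.HubbardFreeKineticLowerBound
import HarnessLib

/-!
# Hubbard ladder — Bounds: sum-rule (diamagnetic) ceilings on flux stiffness, typed

HONEST FRAMING (cell pub-hubbard): ladder R1–R4 with certified numbers; no claim on H/H₀. These
are bounds for MODEL CLASSES (finite-range lattice fermions with gauge-invariant interactions);
no materials claim. Companion text with proofs and constants: `pub-hubbard/paper/bounds.tex`,
status table `pub-hubbard/pub-hubbard-bounds/BOUNDS.md`.

Contents (namespace `Summit.HubbardSuperconductivity.HubbardLadder.Bounds`; every statement is a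
CLOSED `Prop` node, either PROVED here by a `_holds` theorem or tagged `@[conjecture]` = open as a
Lean obligation — the docstring says which are theorems on paper):

* `kinWeightX ψ` — the `e₁`-kinetic weight `K(ψ) = Σ_{x,σ} Re⟨ψ, c†_{x+e₁,σ} c_{x,σ} ψ⟩` on the
  `L × L` torus (the quantity in the tree's f-sum floor
  `stiffness_mul_sq_le_sum_re_hop_of_isGroundStateInSector`).
* `DiamagneticCeiling` (PROVED, `diamagneticCeiling_holds`) — bounds.tex Thm 1(c) in tree form: a flux
  stiffness `ρ_s θ² ≤ E_L(θ) - E_L(0)` is at most `K(ψ)/L²` for EVERY unit sector ground state `ψ`.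
* `OneBodyCeilingDual` (PROVED, `oneBodyCeilingDual_holds`) — bounds.tex Thm 2 (Lieb–Loss bathtub)
  in Legendre-dual form for the full torus hopping operator in any dimension:
  `Re⟨ψ, T_σ ψ⟩ ≤ ν Re⟨ψ, N_σ ψ⟩ + ‖ψ‖² Σ_k (2 Σ_i cos(2πk_i/L) - ν)⁺` for every `ν` — the free Fermi
  sea maximises the kinetic weight among ALL states of the same filling (this is what turns the
  Hazra–Verma–Randeria 2019 "step-function estimate" into a theorem, bounds.tex Remark 2.3).
* `KinWeightXCeiling` (`@[conjecture]`; a theorem on paper, bounds.tex Cor. 2.2(i)) — the x-only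
  bathtub for `K`.
* `GroundStateKinWeightCeiling` (`@[conjecture]`; a theorem on paper, bounds.tex Cor. 2.2(iii)) — the
  sharper rotation-averaged ceiling at SOME sector ground state.
* `HalfBathtubStiffnessBound` (`@[conjecture]`, PROVED FROM the previous node:
  `halfBathtubStiffnessBound_of_ceiling`) — the explicit momentum-sum bound on `ρ_s L²`.
* `JumpFloorArithmetic` (PROVED, `jumpFloorArithmetic_holds`) — the arithmetic skeleton of
  "T_c ≤ (π/8)·ceiling": everything physical (the Nelson–Kosterlitz universal jump, NOT a theorem for
  any interacting lattice model — Oberwolfach Report 52/2024) enters as an explicit hypothesis.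

References (keys of `lean/references.bib`): ParamekantiTrivediRanderia1998 eqs. (ke-bd), (var-bd);
ScalapinoWhiteZhang1993; HazraVermaRanderia2019 eqs. (2)–(4), App. D; HofmannEtAl2022 §II;
NelsonKosterlitz1977; LiebSeiringerSolovejYngvason2005 §5.2; GarbanEtAl2025 (rigorous status of BKT).
-/

noncomputable section

namespace Summit.HubbardSuperconductivity.HubbardLadder.Bounds

open Matrix Finset Real
open Literature.MathematicalPhysics.QuantumLattice
open Literature.MathematicalPhysics.QuantumFieldTheory
open Literature.Probability.LatticeModels
open Literature.MathematicalPhysics.QuantumLattice.LangerMattis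
open Literature.MathematicalPhysics.QuantumLattice.RayleighBound
open scoped ComplexOrder ComplexConjugate

/-! ### The `e₁`-kinetic weight and the diamagnetic ceiling (bounds.tex Thm 1(c)) -/

/-- The `e₁`-kinetic weight `K(ψ) = Σ_{x,σ} Re⟨ψ, c†_{x+e₁,σ} c_{x,σ} ψ⟩` of a Fock vector on the
`L × L` torus (one orientation per bond; `⟨-T_x⟩_ψ = 2t·K(ψ)` for hopping amplitude `t`). -/
def kinWeightX {L : ℕ} [NeZero L] (ψ : Fock (Orb (FermionTorus 2 L))) : ℝ :=
  ∑ x : Site 2 L, ∑ σ : Fin 2,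
    (star ψ ⬝ᵥ ((creation (orb (FermionTorus.ofTorusSite (Site.shift x 0)) σ) *
      annihilation (orb (FermionTorus.ofTorusSite x) σ)) *ᵥ ψ)).re

/-- **Diamagnetic ceiling, T = 0 (PROVED below; Scalapino–White–Zhang `D_s/πe² ≤ ⟨-k_x⟩`,
Paramekanti–Trivedi–Randeria eq. (ke-bd)).** On the `L × L` Hubbard torus (`t = 1`, `L ≥ 3`), if
`ρ_s > 0` is a flux stiffness — `ρ_s θ² ≤ E_L(θ) - E_L(0)` for `|θ| ≤ θ₀`, `E_L(θ) = fluxEnergy L U δ θ`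
the lowest energy of the seam-twisted torus in the `(N_L, S^z = 0)` sector — then
`ρ_s ≤ K(ψ)/L²` for EVERY unit ground state `ψ` of that sector at zero flux. In the notation of
bounds.tex: `ρ_s ≤ 𝒟^E_θ/2 ≤ 𝒦₁/4`. -/
def DiamagneticCeiling : Prop :=
  ∀ (L : ℕ) [NeZero L], 3 ≤ L → ∀ (U δ ρs θ₀ : ℝ), 0 < ρs → 0 < θ₀ →
    (∀ θ : ℝ, |θ| ≤ θ₀ → ρs * θ ^ 2 ≤ fluxEnergy L U δ θ - fluxEnergy L U δ 0) →
    ∀ ψ : Fock (Orb (FermionTorus 2 L)),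
      IsGroundStateInSector (hubbardTorus 2 L 1 U) (2 * ⌊(1 - δ) * (L : ℝ) ^ 2 / 2⌋₊) 0 ψ →
      star ψ ⬝ᵥ ψ = 1 → ρs ≤ kinWeightX ψ / (L : ℝ) ^ 2

/-- Proof of `DiamagneticCeiling`: the tree's f-sum floor
`stiffness_mul_sq_le_sum_re_hop_of_isGroundStateInSector`, divided by `L²`. -/
theorem diamagneticCeiling_holds : DiamagneticCeiling := by
  intro L _ hL U δ ρs θ₀ hρs hθ₀ hst ψ hgs h1
  have hL0 : (0 : ℝ) < (L : ℝ) ^ 2 := by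
    have : (0 : ℝ) < L := Nat.cast_pos.2 (NeZero.pos L)
    positivity
  have hK := stiffness_mul_sq_le_sum_re_hop_of_isGroundStateInSector hL U δ hρs hθ₀ hst hgs h1
  rw [le_div_iff₀ hL0]
  simpa [kinWeightX] using hK

/-! ### The one-body (bathtub) ceiling, dual form, full torus hopping (bounds.tex Thm 2) -/

/-- `min (-1·a - (-ν)) 0 = -max (a - ν) 0`. -/
private theorem min_neg_one_mul_sub_neg (a ν : ℝ) : min (-1 * a - -ν) 0 = -max (a - ν) 0 := by
  rcases le_or_gt ν a with h | h
  · rw [max_eq_left (sub_nonneg.2 h), min_eq_left (by linarith)]; ring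
  · rw [max_eq_right (sub_nonpos.2 h.le), min_eq_right (by linarith)]; ring

/-- The dual bathtub inequality for one spin species on the torus `(ℤ/Lℤ)^d`, `L ≥ 3`:
`Re⟨ψ, T_σ ψ⟩ ≤ ν · Re⟨ψ, N_σ ψ⟩ + ‖ψ‖² · Σ_k (2 Σ_i cos(2πk_i/L) - ν)⁺` for every `ν : ℝ` and every
Fock vector `ψ`, `T_σ = Σ_{x∼y} c†_{xσ} c_{yσ}` (`hopOp`). -/
theorem re_hopOp_le_oneBodyDual {d L : ℕ} [NeZero L] (hL : 3 ≤ L) (σ : Fin 2) (ν : ℝ)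
    (ψ : Fock (Orb (FermionTorus d L))) :
    (star ψ ⬝ᵥ (hopOp (fermionTorusGraph d L) σ *ᵥ ψ)).re ≤
      ν * (star ψ ⬝ᵥ ((∑ x : FermionTorus d L, numberOp x σ) *ᵥ ψ)).re +
        (∑ k : TorusSite d L, max (2 * ∑ i, Real.cos (latticeMomentum L k i) - ν) 0) *
          normSq ψ := by
  -- the tree's bathtub lemma for the Hermitian matrix `hopMatrix G (-1) = -A_G`, potential `-ν`
  have h := FreeKinetic.sum_min_sub_mul_normSq_le σ
    (isHermitian_hopMatrix (fermionTorusGraph d L) (-1)) (-ν) ψ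
  -- its right-hand side is `-Re⟨ψ, T_σ ψ⟩`
  have hR : (star ψ ⬝ᵥ (dGammaSpin σ (hopMatrix (fermionTorusGraph d L) (-1)) *ᵥ ψ)).re =
      -(star ψ ⬝ᵥ (hopOp (fermionTorusGraph d L) σ *ᵥ ψ)).re := by
    rw [FreeKinetic.dGammaSpin_hopMatrix, Matrix.smul_mulVec, dotProduct_smul, smul_eq_mul]
    simp
  -- its spectral sum is (minus) the momentum sum
  have h2 : ∑ i, min ((isHermitian_hopMatrix (fermionTorusGraph d L) (-1)).eigenvalues i - -ν) 0 =
      ∑ k : TorusSite d L, min (-1 * (2 * ∑ i, Real.cos (latticeMomentum L k i)) - -ν) 0 :=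
    sum_eigenvalues_hopMatrix_torus (d := d) hL (-1) (fun x => min (x - -ν) 0)
  have hS : ∑ k : TorusSite d L, min (-1 * (2 * ∑ i, Real.cos (latticeMomentum L k i)) - -ν) 0 =
      -∑ k : TorusSite d L, max (2 * ∑ i, Real.cos (latticeMomentum L k i) - ν) 0 := by
    rw [← Finset.sum_neg_distrib]
    exact Finset.sum_congr rfl fun k _ => min_neg_one_mul_sub_neg _ _
  have h' : (-∑ k : TorusSite d L, max (2 * ∑ i, Real.cos (latticeMomentum L k i) - ν) 0) *
        normSq ψ + -ν * (star ψ ⬝ᵥ ((∑ x : FermionTorus d L, numberOp x σ) *ᵥ ψ)).re ≤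
      -(star ψ ⬝ᵥ (hopOp (fermionTorusGraph d L) σ *ᵥ ψ)).re := by
    calc (-∑ k : TorusSite d L, max (2 * ∑ i, Real.cos (latticeMomentum L k i) - ν) 0) *
          normSq ψ + -ν * (star ψ ⬝ᵥ ((∑ x : FermionTorus d L, numberOp x σ) *ᵥ ψ)).re
        = (∑ i, min ((isHermitian_hopMatrix (fermionTorusGraph d L) (-1)).eigenvalues i - -ν) 0) *
          normSq ψ + -ν * (star ψ ⬝ᵥ ((∑ x : FermionTorus d L, numberOp x σ) *ᵥ ψ)).re := by
          rw [h2, hS]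
      _ ≤ (star ψ ⬝ᵥ (dGammaSpin σ (hopMatrix (fermionTorusGraph d L) (-1)) *ᵥ ψ)).re := h
      _ = -(star ψ ⬝ᵥ (hopOp (fermionTorusGraph d L) σ *ᵥ ψ)).re := hR
  linarith [h']

/-- **One-body ceiling (PROVED below; Lieb–Loss bathtub principle in Legendre-dual form).** On the
torus `(ℤ/Lℤ)^d`, `L ≥ 3`, for every spin `σ`, every `ν : ℝ` and every Fock vector `ψ`:
`Re⟨ψ, T_σ ψ⟩ ≤ ν · Re⟨ψ, N_σ ψ⟩ + ‖ψ‖² · Σ_k (2 Σ_i cos(2πk_i/L) - ν)⁺`. Optimising `ν` gives the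
sum of the `⟨N_σ⟩` largest plane-wave levels: the free Fermi sea maximises the kinetic weight among
ALL states of the same filling — interacting or not, and at any temperature after averaging over a
density matrix. This is the theorem behind the Hazra–Verma–Randeria "single-band" estimate
`D̃ ≤ Σ_k (∂²ε/∂k_x²) n⁰_k` (their eq. (4) with a step function), which they state as an approximation. -/
def OneBodyCeilingDual : Prop :=
  ∀ (d L : ℕ) [NeZero L], 3 ≤ L → ∀ (σ : Fin 2) (ν : ℝ) (ψ : Fock (Orb (FermionTorus d L))),
    (star ψ ⬝ᵥ (hopOp (fermionTorusGraph d L) σ *ᵥ ψ)).re ≤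
      ν * (star ψ ⬝ᵥ ((∑ x : FermionTorus d L, numberOp x σ) *ᵥ ψ)).re +
        (∑ k : TorusSite d L, max (2 * ∑ i, Real.cos (latticeMomentum L k i) - ν) 0) * normSq ψ

/-- Proof of `OneBodyCeilingDual` (`re_hopOp_le_oneBodyDual`). -/
theorem oneBodyCeilingDual_holds : OneBodyCeilingDual :=
  fun _d _L _ hL σ ν ψ => re_hopOp_le_oneBodyDual hL σ ν ψ

/-! ### Open Lean obligations (theorems on paper, bounds.tex §2; to be formalised) -/

/-- OPEN AS A LEAN OBLIGATION (a theorem on paper: bounds.tex Cor. 2.2(i) at `t' = 0`; typed, not yet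
formalised) — **x-only bathtub ceiling for the `e₁`-kinetic weight**: for every Fock vector `ψ` on the
`L × L` torus (`L ≥ 3`) and every `ν`,
`K(ψ) ≤ ν Re⟨ψ, N ψ⟩ + 2 ‖ψ‖² Σ_k (cos(2πk₁/L) - ν)⁺` — the `e₁`-hopping has plane-wave levels
`2 cos(2πk₁/L)`, each carrying weight in `[0, ‖ψ‖²]` per spin. Route to a proof: identify `K` with
`½ Σ_σ Re⟨ψ, dΓ_σ(A_{e₁}) ψ⟩` (`A_{e₁}` the directional adjacency), compute `spec A_{e₁}`, apply
`FreeKinetic.sum_min_sub_mul_normSq_le`. Why it might fail as typed: only through a convention slip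
(orientation / factor 2); the mathematics is the bathtub principle. [status: open] -/
@[conjecture] def KinWeightXCeiling : Prop :=
  ∀ (L : ℕ) [NeZero L], 3 ≤ L → ∀ (ψ : Fock (Orb (FermionTorus 2 L))) (ν : ℝ),
    kinWeightX ψ ≤ ν * (star ψ ⬝ᵥ (totalNumber *ᵥ ψ)).re +
      2 * (∑ k : TorusSite 2 L, max (Real.cos (latticeMomentum L k 0) - ν) 0) * normSq ψ

/-- OPEN AS A LEAN OBLIGATION (a theorem on paper: bounds.tex Cor. 2.2(iii) at `t' = 0`; typed, not
yet formalised) — **rotation-averaged ceiling at a sector ground state**: for `L ≥ 3` and all `U, δ`,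
the `(N_L, S^z = 0)` sector of `hubbardTorus 2 L 1 U`, `N_L = 2⌊(1-δ)L²/2⌋`, contains a unit ground
state `ψ` with `K(ψ) ≤ ν N_L / 2 + Σ_k (cos(2πk₁/L) + cos(2πk₂/L) - ν)⁺` for every `ν` — HALF the
full-hopping bathtub value. On paper: the sector ground projector is invariant under the lattice
rotation (tree: `FockMapOpD4`), so the ground-space averages of `K_x` and `K_y` agree, `K_x + K_y` is
bounded by `OneBodyCeilingDual`, and some element of an orthonormal ground basis lies below the
average. Why it might fail as typed: the sector must be nonempty (it is: `N_L ≤ L²` electrons per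
spin direction fit since `⌊(1-δ)L²/2⌋ ≤ L²` needs `δ ≥ -1`; for `δ < -1` the floor exceeds the
one-spin capacity only if `(1-δ)/2 > 1`, and then `IsGroundStateInSector` is unsatisfiable — so the
statement is restricted to `-1 ≤ δ`). [status: open] -/
@[conjecture] def GroundStateKinWeightCeiling : Prop :=
  ∀ (L : ℕ) [NeZero L], 3 ≤ L → ∀ (U δ : ℝ), -1 ≤ δ →
    ∃ ψ : Fock (Orb (FermionTorus 2 L)),
      IsGroundStateInSector (hubbardTorus 2 L 1 U) (2 * ⌊(1 - δ) * (L : ℝ) ^ 2 / 2⌋₊) 0 ψ ∧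
      star ψ ⬝ᵥ ψ = 1 ∧
      ∀ ν : ℝ, kinWeightX ψ ≤
        ν * ((2 * ⌊(1 - δ) * (L : ℝ) ^ 2 / 2⌋₊ : ℕ) : ℝ) / 2 +
          ∑ k : TorusSite 2 L,
            max (Real.cos (latticeMomentum L k 0) + Real.cos (latticeMomentum L k 1) - ν) 0

/-- OPEN AS A LEAN OBLIGATION, PROVED BELOW FROM `GroundStateKinWeightCeiling`
(`halfBathtubStiffnessBound_of_ceiling`) — **explicit momentum-sum ceiling on the flux stiffness**
(bounds.tex Cor. 2.2(iii) + Thm 1(c); Hazra–Verma–Randeria eq. (3) made a theorem at `T = 0`):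
for `L ≥ 3`, `-1 ≤ δ`, every flux stiffness `ρ_s` of the `(N_L, 0)` sector satisfies, for every `ν`,
`ρ_s L² ≤ ν N_L / 2 + Σ_k (cos(2πk₁/L) + cos(2πk₂/L) - ν)⁺`. At half filling, `ν = 0`, the right
side is `Σ_k (cos + cos)⁺ = (4/π² + o(1)) L²`, i.e. `ρ_s ≤ 0.4053 + o(1)` against the Bloch-type
ceiling `ρ_s ≤ 2` of the tree (`stiffness_le_two`) (erratum 2026-08-19: an earlier version said
`8/π² ≈ 0.81`, which is the ceiling `s_w(1)` on the kinetic weight `𝒦₁ = 2K/L²`, twice the bound on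
`ρ_s ≤ 𝒦₁/2`; the formal statement is unaffected). [status: open] -/
@[conjecture] def HalfBathtubStiffnessBound : Prop :=
  ∀ (L : ℕ) [NeZero L], 3 ≤ L → ∀ (U δ ρs θ₀ : ℝ), -1 ≤ δ → 0 < ρs → 0 < θ₀ →
    (∀ θ : ℝ, |θ| ≤ θ₀ → ρs * θ ^ 2 ≤ fluxEnergy L U δ θ - fluxEnergy L U δ 0) →
    ∀ ν : ℝ, ρs * (L : ℝ) ^ 2 ≤
      ν * ((2 * ⌊(1 - δ) * (L : ℝ) ^ 2 / 2⌋₊ : ℕ) : ℝ) / 2 +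
        ∑ k : TorusSite 2 L,
          max (Real.cos (latticeMomentum L k 0) + Real.cos (latticeMomentum L k 1) - ν) 0

/-- **Composition (PROVED): the rotation-averaged ceiling implies the explicit stiffness bound**, via
the tree's f-sum floor applied to the ground state the ceiling provides. -/
theorem halfBathtubStiffnessBound_of_ceiling (hC : GroundStateKinWeightCeiling) :
    HalfBathtubStiffnessBound := by
  intro L _ hL U δ ρs θ₀ hδ hρs hθ₀ hst ν
  obtain ⟨ψ, hgs, h1, hK⟩ := hC L hL U δ hδ
  have hfloor := stiffness_mul_sq_le_sum_re_hop_of_isGroundStateInSector hL U δ hρs hθ₀ hst hgs h1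
  have hKx : kinWeightX ψ = ∑ x : Site 2 L, ∑ σ : Fin 2,
      (star ψ ⬝ᵥ ((creation (orb (FermionTorus.ofTorusSite (Site.shift x 0)) σ) *
        annihilation (orb (FermionTorus.ofTorusSite x) σ)) *ᵥ ψ)).re := rfl
  exact (hfloor.trans_eq hKx.symm).trans (hK ν)

/-! ### The conditional step, isolated: Nelson–Kosterlitz enters only as a hypothesis -/

/-- **The arithmetic of "T_c ≤ (π/8)·ceiling" (PROVED below; everything physical is a hypothesis).**
For any function `D : ℝ → ℝ` (temperature ↦ infinite-volume stiffness, normalisation of bounds.tex),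
any `Tc`, `c > 0`, `K̄` and `η > 0`: IF `D` has the jump floor `c · Tc ≤ D(T)` for `Tc - η < T < Tc`
(the Nelson–Kosterlitz universal-jump relation for a charge-`q` condensate is `c = 2q²/π`, `q = 2`:
`c = 8/π` — a HYPOTHESIS: existence of the BKT transition is proved for classical XY/Villain
(Fröhlich–Spencer 1981), not the value of the jump, and nothing is proved for interacting lattice
fermions) AND `D(T) ≤ K̄` below `Tc` (Theorems 1–2 of bounds.tex give such temperature-independent
`K̄`, e.g. `K̄ = 8t/π²` at half filling, `t' = 0`), THEN `Tc ≤ K̄/c` (`= (π/8) K̄`, i.e. `Tc ≤ t/π`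
in the example; `0.2996 t` at `n = 0.7`, the Hazra–Verma–Randeria number). -/
def JumpFloorArithmetic : Prop :=
  ∀ (D : ℝ → ℝ) (Tc c Kbar η : ℝ), 0 < c → 0 < η →
    (∀ T : ℝ, Tc - η < T → T < Tc → c * Tc ≤ D T) → (∀ T : ℝ, T < Tc → D T ≤ Kbar) →
    Tc ≤ Kbar / c

/-- Proof of `JumpFloorArithmetic`: evaluate both hypotheses at `T = Tc - η/2`. -/
theorem jumpFloorArithmetic_holds : JumpFloorArithmetic := by
  intro D Tc c Kbar η hc hη hfloor hceil
  have hT1 : Tc - η < Tc - η / 2 := by linarith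
  have hT2 : Tc - η / 2 < Tc := by linarith
  have h1 := hfloor (Tc - η / 2) hT1 hT2
  have h2 := hceil (Tc - η / 2) hT2
  rw [le_div_iff₀ hc]
  linarith

end Summit.HubbardSuperconductivity.HubbardLadder.Bounds

end
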